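import Literature.Combinatorics.Sahi2008.ConditionallyIncreasing
import HarnessLib

/-!
# Gladkov (2024), Theorem 3.2 with Remark 3.3: the strong FKG inequality `µ(A)µ(B) ≥ e₂(µ(C₁),…,µ(C_k))`
# for every monotone image of independent coins on ANY finite poset — in particular for every FKG weight on
# a finite distributive lattice and every CIS law on the cube (weight level)

CITATION HEADER.  Source: N. Gladkov, *A strong FKG inequality for multiple events*, Bull. London Math. Soc.
56 (2024) 2794–2801 [Gladkov2024StrongFKG], read 2026-08-20 from the materialised arXiv text
(`lit read arxiv:2305.02653`, chunk p0005).  Verbatim: "Proposition (FKGtoFUI) allows us to generalize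
Theorem (Harris+) to all UI-measures. In particular, it holds for all measures with the FKG property.
**Theorem 3.2.** Let `µ` be a UI measure on `H_n`, and `H_n = A ⊔ C_1 ⊔ C_2 ⊔ ⋯ ⊔ C_k ⊔ B` for `k ≥ 2` such
that all sets of the form `A ∪ C_i` are closed upwards. Then `µ(A)µ(B) ≥ e_2(µ(C_1), …, µ(C_k))`.
*Proof.* Suppose `µ` is an FUI measure on `(X_1, …, X_n)`. Then we can assume `X_i`'s are binary
non-decreasing functions of independent `m` Bernoulli variables `Y_1, …, Y_m` as in the proof of Proposition
(FKGtoFUI). All sets `A ∪ C_j` are closed upwards in the hypercube generated by `Y_i`'s, so by Theorem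
(Harris+) we have inequality (alsoE2). …"  and "**Remark 3.3.** Following the original proof in [FKG71], one
may extend Theorem (FKG+) to general distributive lattices."

The tree has Theorem 2.1 (= "Harris+", product measures) as
`Literature.Probability.LatticeModels.prodBernoulli_strongHarris` and Theorem 3.2 at MEASURE level on the cube
`2^W` (`Kahn2022.IsFUI.strongHarris`, `IsUI.strongHarris`, `strongHarris_of_isFKGMeasure`, all in
`KahnQuestionOne.lean`).  This file is the printed proof of Theorem 3.2 run at WEIGHT level for an arbitrary
finite target poset `γ` — pull the partition `A, C_i, B` back along the monotone coin representation `G` and apply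
Theorem 2.1 on the cube — which gives Remark 3.3 (every FKG weight on a finite distributive lattice, via the
tree's `IsFKGMeasure.exists_coinRepresentation`, Birkhoff + van den Berg/Kahn) and the CIS laws of
`ConditionallyIncreasing.lean` (Barlow–Proschan) at no extra cost.

## What is formalised (everything PROVED; no definition, no named fact)

* `ex_pushWeight_coinWeight_ind` — bridge: for `μ = G_* (coinWeight q)`, `E_μ(1_X) = prodBernoulli q' ((G ∘ setCube m)⁻¹ X)`.
* `strongHarris_pushWeight_coinWeight` — Theorem 3.2's proof for any monotone `G : {0,1}^m → γ`, `γ` a finite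
  preorder: `(Σ_i μ(C_i))² − Σ_i μ(C_i)² ≤ 2 μ(A) μ(B)` with `μ(X) := E_μ(1_X)`, `B = (A ∪ ⋃ C_i)ᶜ`
  (the tree's form of `µ(A)µ(B) ≥ e₂`; the index set `s` is an arbitrary finset, `k ≤ 1` being trivial).
* `IsFKGMeasure.strongHarris` — **Remark 3.3 / "in particular … all measures with the FKG property"**: every FKG
  probability weight on a finite distributive lattice; `IsFKGMeasure.strongHarris_finset` — the same with finset
  masses `Σ_{x ∈ X} μ x`.
* `IsCIS.strongHarris` — every CIS probability weight on `{0,1}^k` [BarlowProschan1975 construction + Thm. 3.2].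
-/

noncomputable section

namespace Literature.Combinatorics.Sahi2008

open Finset MeasureTheory Kahn2022
open Literature.Probability.LatticeModels (prodBernoulli prodBernoulli_strongHarris)
open Literature.Probability.Percolation.DecisionTree (ind ind_of_mem ind_of_not_mem)

/-! ### The bridge from coin weights to the product measure on `2^{[m]}` -/

section Bridge

variable {γ : Type*} [Fintype γ]

omit [Fintype γ] in
/-- The indicator pulled back along `G` is the indicator of the preimage (plumbing). [folklore] -/
private theorem ind_comp {β : Type*} (X : Set γ) (G : β → γ) : ind X ∘ G = ind (G ⁻¹' X) := by
  funext b
  by_cases h : G b ∈ X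
  · rw [Function.comp_apply, ind_of_mem h, ind_of_mem (Set.mem_preimage.2 h)]
  · rw [Function.comp_apply, ind_of_not_mem h, ind_of_not_mem (fun h' => h (Set.mem_preimage.1 h'))]

/-- **Bridge.**  For a monotone-image weight `μ = G_* (coinWeight q)` (`q ∈ [0,1]^m`) on a finite type `γ` and
any `X ⊆ γ`: `E_μ(1_X) = (prodBernoulli q')((G ∘ setCube m)⁻¹ X)`, where `q'` is `q` read in `[0,1]` and
`setCube m : 2^{[m]} ≃ {0,1}^m`.  ("we can assume `X_i`'s are … functions of independent `m` Bernoulli variables")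
[cite: Gladkov2024StrongFKG, Thm. 3.2 (proof)] -/
theorem ex_pushWeight_coinWeight_ind {m : ℕ} (q : Fin m → ℝ) (hq : ∀ i, 0 ≤ q i ∧ q i ≤ 1)
    (G : (Fin m → Bool) → γ) (X : Set γ) :
    ex (pushWeight (coinWeight q) G) (ind X) =
      (prodBernoulli (fun i => (⟨q i, (hq i).1, (hq i).2⟩ : unitInterval))).real
        ((G ∘ setCube m) ⁻¹' X) := by
  classical
  rw [ex_pushWeight, ind_comp, ← ex_bernoulliWeight_ind]
  unfold ex
  rw [← (setCube m).sum_comp]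
  refine sum_congr rfl fun T _ => ?_
  rw [bernoulliWeight_eq_coinWeight_setCube q hq T]
  rfl

end Bridge

/-! ### Theorem 3.2 at weight level, for any finite target poset -/

section Weight

variable {γ : Type*} [Fintype γ] [Preorder γ]

/-- **Gladkov's Theorem 3.2, the printed proof at weight level.**  Let `μ = G_* (coinWeight q)` be the law of a
MONOTONE function `G : {0,1}^m → γ` of independent coins (`q ∈ [0,1]^m`), `γ` any finite preorder; let `A ⊆ γ`
be closed upwards and `C_i` (`i ∈ s`) pairwise disjoint, disjoint from `A`, with every `A ∪ C_i` closed upwards;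
`B := (A ∪ ⋃ C_i)ᶜ`.  Then `(Σ_i μ(C_i))² − Σ_i μ(C_i)² ≤ 2 μ(A) μ(B)`, i.e. `μ(A)μ(B) ≥ e₂(μ(C_i))`, where
`μ(X) = E_μ(1_X)`.  Proof as printed: all the sets pull back to up-sets / disjoint cells of the cube `2^{[m]}`
along `G ∘ setCube m`, where Theorem 2.1 (`prodBernoulli_strongHarris`) applies.
[cite: Gladkov2024StrongFKG, Thm. 3.2 (proof) and Thm. 2.1] -/
theorem strongHarris_pushWeight_coinWeight {m : ℕ} {q : Fin m → ℝ} (hq : ∀ i, 0 ≤ q i ∧ q i ≤ 1)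
    {G : (Fin m → Bool) → γ} (hG : Monotone G) {κ : Type*} (s : Finset κ) {A : Set γ} {C : κ → Set γ}
    (hdisj : ∀ i ∈ s, ∀ j ∈ s, i ≠ j → Disjoint (C i) (C j))
    (hdisjA : ∀ i ∈ s, Disjoint A (C i)) (hup : ∀ i ∈ s, IsUpperSet (A ∪ C i)) (hA : IsUpperSet A) :
    (∑ i ∈ s, ex (pushWeight (coinWeight q) G) (ind (C i))) ^ 2 -
        ∑ i ∈ s, ex (pushWeight (coinWeight q) G) (ind (C i)) ^ 2 ≤
      2 * (ex (pushWeight (coinWeight q) G) (ind A) *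
        ex (pushWeight (coinWeight q) G) (ind (A ∪ ⋃ i ∈ s, C i)ᶜ)) := by
  classical
  let Ψ : Set (Fin m) → γ := G ∘ setCube m
  have hΨ : Monotone Ψ := hG.comp (setCube_mono m)
  simp only [ex_pushWeight_coinWeight_ind q hq G]
  have hpre : (G ∘ setCube m) ⁻¹' (A ∪ ⋃ i ∈ s, C i)ᶜ =
      ((Ψ ⁻¹' A) ∪ ⋃ i ∈ s, Ψ ⁻¹' (C i))ᶜ := by
    ext T
    simp only [Ψ, Set.mem_preimage, Set.mem_compl_iff, Set.mem_union, Set.mem_iUnion]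
  rw [hpre]
  exact prodBernoulli_strongHarris _ s
    (fun i hi j hj hij => (hdisj i hi j hj hij).preimage Ψ)
    (fun i hi => (hdisjA i hi).preimage Ψ)
    (fun i hi => by
      rw [← Set.preimage_union]
      exact (hup i hi).preimage hΨ)
    (hA.preimage hΨ)

end Weight

/-! ### Remark 3.3: every FKG weight on a finite distributive lattice -/

section Lattice

variable {α : Type*} [DistribLattice α] [Fintype α]

/-- **Strong FKG for FKG posets** ("In particular, it holds for all measures with the FKG property"; Remark 3.3:
"one may extend Theorem (FKG+) to general distributive lattices"): for an FKG probability weight `μ` on a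
finite distributive lattice `α`, an up-set `A`, pairwise disjoint cells `C_i` disjoint from `A` with every
`A ∪ C_i` an up-set, and `B = (A ∪ ⋃ C_i)ᶜ`: `(Σ μ(C_i))² − Σ μ(C_i)² ≤ 2 μ(A) μ(B)` with `μ(X) = E_μ(1_X)`.
Proof: `μ` is a monotone image of independent coins (`IsFKGMeasure.exists_coinRepresentation` — Birkhoff
embedding + van den Berg/Kahn) and `strongHarris_pushWeight_coinWeight`.
[cite: Gladkov2024StrongFKG, Thm. 3.2 and Rem. 3.3] -/
theorem IsFKGMeasure.strongHarris {μ : α → ℝ} (hμ : IsFKGMeasure μ) {κ : Type*} (s : Finset κ)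
    {A : Set α} {C : κ → Set α}
    (hdisj : ∀ i ∈ s, ∀ j ∈ s, i ≠ j → Disjoint (C i) (C j))
    (hdisjA : ∀ i ∈ s, Disjoint A (C i)) (hup : ∀ i ∈ s, IsUpperSet (A ∪ C i)) (hA : IsUpperSet A) :
    (∑ i ∈ s, ex μ (ind (C i))) ^ 2 - ∑ i ∈ s, ex μ (ind (C i)) ^ 2 ≤
      2 * (ex μ (ind A) * ex μ (ind (A ∪ ⋃ i ∈ s, C i)ᶜ)) := by
  obtain ⟨m, q, G, hq, hG, hrep⟩ := hμ.exists_coinRepresentation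
  rw [hrep]
  exact strongHarris_pushWeight_coinWeight (fun i => ⟨(hq i).1.le, (hq i).2.le⟩) hG s hdisj hdisjA hup hA

omit [DistribLattice α] in
/-- `E_μ(1_X) = Σ_{x ∈ X} μ x` for a finset `X` (plumbing). [folklore] -/
private theorem ex_ind_coe [DecidableEq α] (μ : α → ℝ) (X : Finset α) :
    ex μ (ind (↑X : Set α)) = ∑ x ∈ X, μ x := by
  unfold ex
  have h : ∀ x, μ x * ind (↑X : Set α) x = if x ∈ X then μ x else 0 := fun x => by
    by_cases hx : x ∈ X
    · rw [ind_of_mem (Finset.mem_coe.2 hx), mul_one, if_pos hx]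
    · rw [ind_of_not_mem (fun h => hx (Finset.mem_coe.1 h)), mul_zero, if_neg hx]
  simp only [h]
  rw [Finset.sum_ite_mem, Finset.univ_inter]

/-- **Strong FKG for FKG posets, finset masses** — the same statement with `μ(X) = Σ_{x ∈ X} μ x` for finsets
`A`, `C_i` and `B = (A ∪ ⋃ C_i)ᶜ` (finset complement). [cite: Gladkov2024StrongFKG, Thm. 3.2 and Rem. 3.3] -/
theorem IsFKGMeasure.strongHarris_finset [DecidableEq α] {μ : α → ℝ} (hμ : IsFKGMeasure μ) {κ : Type*}
    (s : Finset κ) {A : Finset α} {C : κ → Finset α}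
    (hdisj : ∀ i ∈ s, ∀ j ∈ s, i ≠ j → Disjoint (C i) (C j))
    (hdisjA : ∀ i ∈ s, Disjoint A (C i)) (hup : ∀ i ∈ s, IsUpperSet (↑(A ∪ C i) : Set α))
    (hA : IsUpperSet (↑A : Set α)) :
    (∑ i ∈ s, ∑ x ∈ C i, μ x) ^ 2 - ∑ i ∈ s, (∑ x ∈ C i, μ x) ^ 2 ≤
      2 * ((∑ x ∈ A, μ x) * ∑ x ∈ (A ∪ s.biUnion C)ᶜ, μ x) := by
  have h := hμ.strongHarris s (A := (↑A : Set α)) (C := fun i => (↑(C i) : Set α))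
    (fun i hi j hj hij => Finset.disjoint_coe.2 (hdisj i hi j hj hij))
    (fun i hi => Finset.disjoint_coe.2 (hdisjA i hi))
    (fun i hi => by rw [← Finset.coe_union]; exact hup i hi) hA
  have hB : ((↑A : Set α) ∪ ⋃ i ∈ s, (↑(C i) : Set α))ᶜ = (↑((A ∪ s.biUnion C)ᶜ) : Set α) := by
    rw [Finset.coe_compl, Finset.coe_union, Finset.coe_biUnion]
    rfl
  rw [hB] at h
  simpa only [ex_ind_coe] using h

end Lattice

/-! ### CIS laws on the cube -/

/-- **Strong FKG for CIS laws**: a probability weight on `{0,1}^k` that is conditionally increasing in sequence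
satisfies Gladkov's strong Harris inequality (it is a monotone image of independent coins by the
Barlow–Proschan construction, `IsCIS.exists_coinRepresentation_cube`).
[cite: Gladkov2024StrongFKG, Thm. 3.2; BarlowProschan1975, Ch. 5 §4, Lemma 4.8] -/
theorem IsCIS.strongHarris {k : ℕ} {μ : (Fin k → Bool) → ℝ} (hcis : IsCIS k μ) (h0 : ∀ x, 0 ≤ μ x)
    (h1 : ∑ x, μ x = 1) {κ : Type*} (s : Finset κ) {A : Set (Fin k → Bool)} {C : κ → Set (Fin k → Bool)}
    (hdisj : ∀ i ∈ s, ∀ j ∈ s, i ≠ j → Disjoint (C i) (C j))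
    (hdisjA : ∀ i ∈ s, Disjoint A (C i)) (hup : ∀ i ∈ s, IsUpperSet (A ∪ C i)) (hA : IsUpperSet A) :
    (∑ i ∈ s, ex μ (ind (C i))) ^ 2 - ∑ i ∈ s, ex μ (ind (C i)) ^ 2 ≤
      2 * (ex μ (ind A) * ex μ (ind (A ∪ ⋃ i ∈ s, C i)ᶜ)) := by
  obtain ⟨m, q, G, hq, hG, hrep⟩ := hcis.exists_coinRepresentation_cube k μ h0 h1
  rw [hrep]
  exact strongHarris_pushWeight_coinWeight (fun i => ⟨(hq i).1.le, (hq i).2.le⟩) hG s hdisj hdisjA hup hA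

end Literature.Combinatorics.Sahi2008
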